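import Literature.Geometry.DiscreteGeometry.ShellCensusFrame
import Literature.Analysis.ValidatedNumerics.IntervalFunctions
import Literature.Geometry.DiscreteGeometry.LayerShells
import HarnessLib

/-!
# Census certificates for gapped shells: claims, boxes, the checker, the text format

Topic `Literature/Geometry/DiscreteGeometry`; part 2 of 4 of the replayer for the gapped-shell
census (request `defn-ShellCensusReplay`, crux `ShellCensus` of route `GappedShellCensus`; part 1
`ShellCensusFrame.lean`, soundness in `ShellCensusReplaySound.lean`, the twelve-neighbour
instance in `ShellCensusTwelve.lean`). Everything here is DATA and COMPUTABLE (the checker is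
structurally recursive and runs in the kernel by `decide` on toy certificates and as compiled
code by `native_decide` on the lane's), plus the semantic predicates the soundness theorem is
about. Built on `Literature/Analysis/ValidatedNumerics` (`Box`, `NonemptyInterval ℚ` with exact
`+`/`−`, the tight square `sqI`, inclusion theorems) — the "interval-windows checker class" —
and on the coordinate formulas `norm_sq_fin3` / `dist_sq_fin3` of `LayerShells.lean`.

## The problem and the claim language

A `Spec` fixes `n` points `t : Fin n → ℝ³` with `rlo ≤ ‖t k‖ ≤ rhi`, all pairwise distances
`≥ dlo` and each pair either a BOND (`dist ≤ dhi`) or FAR (`gap ≤ dist`) (`Admissible`), a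
closeness `eta`, and rational ANCHORS approximating finitely many patterns to within `eps`
(`Patterns` = the exact patterns, supplied on the proof side). `Claim S` (for a list `S` of
decided pairs `(k, l, bond?)`) says: every admissible `t` satisfying `S` is `eta`-close, after a
linear isometry and a relabelling, to some pattern (`Good`). `Claim []` is the census.

## Certificates (`Tree`, `Census`) and the checker (`Tree.check`, `Census.check`)

A census is a LIST of entries `(S, tree)` checked in order; the constraint lists of earlier
entries form the context of later ones (a DAG: symmetric cases are proved once and REFERENCED).
Tree nodes: `case k l` (bond / far split — the admissibility alternative), `ref π j` (the claim
follows from context claim `j` relabelled by the permutation `π`, by monotonicity: more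
constraints, weaker claim — this is how the lane's canonical-form deduplication of bond/far
graphs (nauty) enters: it emits the explicit relabelling, Lean checks list inclusion), `frame`
(fix the frame of `ShellCensusFrame.exists_frame` and start a box search on the root box
`rootBox`: `3n` coordinates, `t 0 = (0, 0, z)`, `z ∈ [rlo, rhi]`, `(t 1).y = 0 ≤ (t 1).x`,
`0 ≤ (t 2).y`, all in `[−rhi, rhi]`), `split axis cut` (bisect a coordinate at a rational),
`empty w` (the box is EXCLUDED: the `Witness` names the one constraint — empty interval, norm
window, hard core, bond/far gap of an undecided pair, a decided pair's window — violated on the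
whole box by interval evaluation of a squared norm / distance, `sqNormIv` / `sqDistIv`; Moore's
exclusion test), `accept pat M σ` (the box is ACCEPTED: `M` is an exactly orthogonal rational
matrix, `σ` a permutation, and the interval upper bound of `dist (t k) (M · anchor[pat][σ k])²`
is `≤ (eta − eps)²` for every `k`, `sqDistPtIv`). Contractions (HC4 / Krawczyk steps of the
lane's solver) are encoded as splits whose off-cuts are `empty`. `Census.check` also verifies the
sign conditions `okB` on the data and that some entry has `S = []`.

## Text format (`Census.ofText`)

Realistic certificates (10⁵–10⁷ nodes) are shipped as a string of integers and decoded at check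
time (grammar in the section docstring below; `quatMat` turns an integer quaternion into an
exactly orthogonal matrix). Guidance for the lane: dyadic cuts of modest precision keep the exact
rational arithmetic fast; one `empty`/`accept` leaf costs one/`n` interval evaluations; keep
`≤ 10⁴` entries and `≲ 10⁷` tokens per file and chain files with
`Census.claims_append_of_checkFrom` (`ShellCensusReplaySound.lean`).

## References
* R. E. Moore, *Interval Analysis* (1966), Theorem 3.1 (inclusion property), §4.4 (exclusion
  by subdivision). [cite: Moore1966, Theorem 3.1, §4.4]
* O. R. Musin, A. S. Tarasov, DCG 48 (2012), §4 (graph list + certified elimination). [cite: MusinTarasov2012, §4]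
-/

namespace Literature.Geometry.DiscreteGeometry

open Literature.Analysis.ValidatedNumerics NonemptyInterval Finset

/-- Euclidean `3`-space. -/
local notation "E3" => EuclideanSpace ℝ (Fin 3)

namespace ShellCensus

/-! ### Specifications, configurations, claims -/

/-- The numerical data of a gapped-shell census: `n` points with norms in `[rlo, rhi]`, all
pairwise distances `≥ dlo` and each either `≤ dhi` ("bond") or `≥ gap` ("far"); conclusion:
`eta`-closeness to one of the patterns whose rational `eps`-approximations are `anchors`
(pattern `i`, point `k` ↦ `anchors[i][k] : ℚ³`). [folklore] -/
structure Spec where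
  /-- number of points -/
  n : ℕ
  /-- lower norm bound -/
  rlo : ℚ
  /-- upper norm bound -/
  rhi : ℚ
  /-- hard-core lower distance bound (all pairs) -/
  dlo : ℚ
  /-- upper end of the bond window -/
  dhi : ℚ
  /-- lower end of the far window -/
  gap : ℚ
  /-- closeness to be certified -/
  eta : ℚ
  /-- accuracy of the rational anchors -/
  eps : ℚ
  /-- rational approximations of the patterns -/
  anchors : List (List (ℚ × ℚ × ℚ))

/-- A decided pair: `(k, l, true)` = "bond" (`dist ≤ dhi`), `(k, l, false)` = "far"
(`gap ≤ dist`). [folklore] -/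
abbrev Constraint : Type := ℕ × ℕ × Bool

namespace Spec

variable (P : Spec)

/-- Anchor `k` of pattern `i` (junk `(0,0,0)` out of range; the checker guards indices). [folklore] -/
def anchor (i k : ℕ) : ℚ × ℚ × ℚ := (P.anchors.getD i []).getD k (0, 0, 0)

/-- Sign and shape conditions on the data under which the checker's tests are sound
(all decidable; verified by `Census.check`). [folklore] -/
def okB : Bool :=
  decide (0 ≤ P.rlo) && decide (0 ≤ P.dlo) && decide (0 ≤ P.gap) && decide (0 ≤ P.eps) &&
    decide (P.eps ≤ P.eta) && decide (3 ≤ P.n)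

/-- **Admissible configurations**: the hypotheses of the census for an injective `n`-tuple. [folklore] -/
structure Admissible (t : Fin P.n → E3) : Prop where
  /-- the points are distinct -/
  inj : Function.Injective t
  /-- norms at least `rlo` -/
  norm_lo : ∀ k, (P.rlo : ℝ) ≤ ‖t k‖
  /-- norms at most `rhi` -/
  norm_hi : ∀ k, ‖t k‖ ≤ (P.rhi : ℝ)
  /-- hard core -/
  dist_lo : ∀ k l, k ≠ l → (P.dlo : ℝ) ≤ dist (t k) (t l)
  /-- bond-or-far alternative -/
  dist_alt : ∀ k l, k ≠ l → dist (t k) (t l) ≤ (P.dhi : ℝ) ∨ (P.gap : ℝ) ≤ dist (t k) (t l)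

/-- The configuration satisfies the decided constraints (out-of-range indices impose nothing). [folklore] -/
def Sat (S : List Constraint) (t : Fin P.n → E3) : Prop :=
  ∀ c ∈ S, ∀ (hk : c.1 < P.n) (hl : c.2.1 < P.n),
    (c.2.2 = true → dist (t ⟨c.1, hk⟩) (t ⟨c.2.1, hl⟩) ≤ (P.dhi : ℝ)) ∧
    (c.2.2 = false → (P.gap : ℝ) ≤ dist (t ⟨c.1, hk⟩) (t ⟨c.2.1, hl⟩))

/-- Exact realisations of the patterns, `eps`-close to the rational anchors. [folklore] -/
structure Patterns where
  /-- pattern `i` as an `n`-tuple of points -/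
  pts : List (Fin P.n → E3)
  /-- one exact pattern per anchor table -/
  len_eq : pts.length = P.anchors.length
  /-- anchors approximate the patterns pointwise to within `eps` -/
  close : ∀ (i : ℕ) (hi : i < pts.length) (k : Fin P.n), dist (pts[i] k) (qpt (P.anchor i k)) ≤ (P.eps : ℝ)

end Spec

namespace Spec

variable (P : Spec)

/-- The conclusion of the census for a tuple: close to some pattern. [folklore] -/
def Good (Q : P.Patterns) (t : Fin P.n → E3) : Prop :=
  ∃ (i : ℕ) (hi : i < Q.pts.length), TupleClose (P.eta : ℝ) t Q.pts[i]

/-- **The claim of a constraint list** (frame-free): every admissible configuration satisfying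
the constraints is good. [folklore] -/
def Claim (Q : P.Patterns) (S : List Constraint) : Prop :=
  ∀ t : Fin P.n → E3, P.Admissible t → P.Sat S t → P.Good Q t

end Spec

/-! ### Coordinates in a box -/

/-- Flattening of an `n`-tuple of points of `ℝ³` to `ℕ → ℝ`: coordinate `i` of point `k` is
variable `3k + i` (zero beyond `3n`). [folklore] -/
noncomputable def flat {n : ℕ} (t : Fin n → E3) : ℕ → ℝ := fun m =>
  if h : m / 3 < n then t ⟨m / 3, h⟩ ⟨m % 3, Nat.mod_lt _ (by norm_num)⟩ else 0

/-- `flat t (3k + i) = (t k) i`. [folklore] -/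
theorem flat_apply {n : ℕ} (t : Fin n → E3) (k : Fin n) (i : Fin 3) :
    flat t (3 * k + i) = t k i := by
  have h1 : (3 * (k : ℕ) + i) / 3 = k := by omega
  have h2 : (3 * (k : ℕ) + i) % 3 = i := by omega
  have hk : (3 * (k : ℕ) + i) / 3 < n := by rw [h1]; exact k.2
  unfold flat
  rw [dif_pos hk]
  have e1 : (⟨(3 * (k : ℕ) + i) / 3, hk⟩ : Fin n) = k := Fin.ext h1
  have e2 : (⟨(3 * (k : ℕ) + i) % 3, Nat.mod_lt _ (by norm_num)⟩ : Fin 3) = i := Fin.ext h2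
  rw [e1, e2]

/-- The interval of coordinate `i` of point `k` in the box `B`. [folklore] -/
def cIv (B : Box) (k i : ℕ) : NonemptyInterval ℚ := B.toIvl (3 * k + i)

/-- Enclosure of `‖t k‖²`. [cite: Moore1966, Theorem 3.1] -/
def sqNormIv (B : Box) (k : ℕ) : NonemptyInterval ℚ :=
  (cIv B k 0).sqI + (cIv B k 1).sqI + (cIv B k 2).sqI

/-- Enclosure of `dist (t k) (t l)²`. [cite: Moore1966, Theorem 3.1] -/
def sqDistIv (B : Box) (k l : ℕ) : NonemptyInterval ℚ :=
  (cIv B k 0 - cIv B l 0).sqI + (cIv B k 1 - cIv B l 1).sqI + (cIv B k 2 - cIv B l 2).sqI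

/-- Enclosure of `dist (t k) a²` for a rational point `a`. [cite: Moore1966, Theorem 3.1] -/
def sqDistPtIv (B : Box) (k : ℕ) (a : ℚ × ℚ × ℚ) : NonemptyInterval ℚ :=
  (cIv B k 0 - pure a.1).sqI + (cIv B k 1 - pure a.2.1).sqI + (cIv B k 2 - pure a.2.2).sqI


section Enclosures

variable {n : ℕ} {B : Box} {t : Fin n → E3}

/-- A coordinate of a boxed configuration lies in its interval. [folklore] -/
theorem coord_mem (ht : B.mem (flat t)) (k : Fin n) (i : Fin 3) :
    t k i ∈ (cIv B k i).ratCast ℝ := by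
  have h := Box.mem_toIvl ht (3 * k + i)
  rwa [flat_apply] at h

/-- Inclusion property of `sqNormIv`. [cite: Moore1966, Theorem 3.1] -/
theorem norm_sq_mem (ht : B.mem (flat t)) (k : Fin n) :
    ‖t k‖ ^ 2 ∈ (sqNormIv B k).ratCast ℝ := by
  rw [norm_sq_fin3]
  exact isSoundFun₂_add (isSoundFun₂_add (sq_mem_sqI (coord_mem ht k 0)) (sq_mem_sqI (coord_mem ht k 1)))
    (sq_mem_sqI (coord_mem ht k 2))

/-- Inclusion property of `sqDistIv`. [cite: Moore1966, Theorem 3.1] -/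
theorem dist_sq_mem (ht : B.mem (flat t)) (k l : Fin n) :
    dist (t k) (t l) ^ 2 ∈ (sqDistIv B k l).ratCast ℝ := by
  rw [dist_sq_fin3]
  exact isSoundFun₂_add (isSoundFun₂_add
    (sq_mem_sqI (isSoundFun₂_sub (coord_mem ht k 0) (coord_mem ht l 0)))
    (sq_mem_sqI (isSoundFun₂_sub (coord_mem ht k 1) (coord_mem ht l 1))))
    (sq_mem_sqI (isSoundFun₂_sub (coord_mem ht k 2) (coord_mem ht l 2)))

/-- Inclusion property of `sqDistPtIv`. [cite: Moore1966, Theorem 3.1] -/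
theorem dist_pt_sq_mem (ht : B.mem (flat t)) (k : Fin n) (a : ℚ × ℚ × ℚ) :
    dist (t k) (qpt a) ^ 2 ∈ (sqDistPtIv B k a).ratCast ℝ := by
  rw [dist_sq_fin3, qpt_apply_zero, qpt_apply_one, qpt_apply_two]
  have hc : ∀ q : ℚ, (q : ℝ) ∈ (pure q : NonemptyInterval ℚ).ratCast ℝ := fun q => by
    rw [ratCast_pure]; exact mem_pure_self _
  exact isSoundFun₂_add (isSoundFun₂_add
    (sq_mem_sqI (isSoundFun₂_sub (coord_mem ht k 0) (hc _)))
    (sq_mem_sqI (isSoundFun₂_sub (coord_mem ht k 1) (hc _))))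
    (sq_mem_sqI (isSoundFun₂_sub (coord_mem ht k 2) (hc _)))

end Enclosures

/-! ### Certificates -/

/-- The reason why a box contains no admissible configuration satisfying the constraints: an
empty coordinate interval, a norm bound, the hard core, the bond/far gap for an undecided pair,
or a decided pair's window — each violated on the whole box by interval arithmetic. [folklore] -/
inductive Witness : Type
  /-- coordinate `axis` has an empty interval -/
  | void (axis : ℕ)
  /-- `‖t k‖ < rlo` on the box -/
  | normLo (k : ℕ)
  /-- `‖t k‖ > rhi` on the box -/
  | normHi (k : ℕ)
  /-- `dist (t k) (t l) < dlo` on the box -/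
  | distLo (k l : ℕ)
  /-- `dhi < dist (t k) (t l) < gap` on the box -/
  | gap (k l : ℕ)
  /-- a bond pair with `dist > dhi` on the box -/
  | bondHi (k l : ℕ)
  /-- a far pair with `dist < gap` on the box -/
  | farLo (k l : ℕ)
  deriving DecidableEq, Repr, Inhabited

/-- **Census certificate trees.** `case`: split on a pair being a bond or far; `ref`: the claim
follows from the earlier established claim `j` relabelled by `perm`; `frame`: fix the frame and
start a box search from the root box; `split`: bisect a coordinate; `empty`: the box is excluded
by the witness; `accept`: every configuration in the box is close to pattern `pat` placed by the
orthogonal matrix `mat` with the points matched by `perm`. [folklore] -/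
inductive Tree : Type
  /-- case split on the pair `(k, l)` -/
  | case (k l : ℕ) (bond far : Tree)
  /-- back-reference to claim `j` of the context, relabelled -/
  | ref (perm : List ℕ) (j : ℕ)
  /-- fix the frame -/
  | frame (sub : Tree)
  /-- bisect coordinate `axis` at `cut` -/
  | split (axis : ℕ) (cut : ℚ) (lo hi : Tree)
  /-- excluded box -/
  | empty (w : Witness)
  /-- accepted box -/
  | accept (pat : ℕ) (mat : List ℚ) (perm : List ℕ)
  deriving Inhabited, DecidableEq

/-- Relabelling of a constraint list along `k ↦ π[k]`. [folklore] -/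
def relabel (π : List ℕ) (S : List Constraint) : List Constraint :=
  S.map fun c => (papp π c.1, papp π c.2.1, c.2.2)

/-- The exactly orthogonal rational matrix `s · R(q)/|q|²` of a rational quaternion
`q = a + bi + cj + dk ≠ 0` (`s = 1`: the rotation of `q`; `s = −1`: a rotoreflection); the
identity for `q = 0`. A convenient way for the lane to PRODUCE the matrix of an `accept` leaf;
the checker re-verifies orthogonality, so nothing here needs proof. [folklore] -/
def quatMat (a b c d s : ℚ) : List ℚ :=
  let N := a ^ 2 + b ^ 2 + c ^ 2 + d ^ 2
  if N = 0 then [1, 0, 0, 0, 1, 0, 0, 0, 1] else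
    [a ^ 2 + b ^ 2 - c ^ 2 - d ^ 2, 2 * (b * c - a * d), 2 * (b * d + a * c),
      2 * (b * c + a * d), a ^ 2 - b ^ 2 + c ^ 2 - d ^ 2, 2 * (c * d - a * b),
      2 * (b * d - a * c), 2 * (c * d + a * b), a ^ 2 - b ^ 2 - c ^ 2 + d ^ 2].map
      fun x => s * x / N

namespace Spec

variable (P : Spec)

/-- Coordinate intervals of the root box of a frame: `t 0 = (0, 0, z)` with `z ∈ [rlo, rhi]`,
`t 1 = (x, 0, z)` with `x ≥ 0`, `(t 2).y ≥ 0`, all coordinates in `[−rhi, rhi]`. [folklore] -/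
def rootIvl (m : ℕ) : ℚ × ℚ :=
  if m = 0 ∨ m = 1 ∨ m = 4 then (0, 0)
  else if m = 2 then (P.rlo, P.rhi)
  else if m = 3 ∨ m = 7 then (0, P.rhi)
  else (-P.rhi, P.rhi)

/-- The root box of a frame (`3n` coordinates). [folklore] -/
def rootBox : Box := (List.range (3 * P.n)).map P.rootIvl

/-- **The exclusion tests.** [cite: Moore1966, Theorem 3.1, §4.4] -/
def witnessOK (S : List Constraint) (B : Box) : Witness → Bool
  | .void a => decide ((B.ivl a).2 < (B.ivl a).1)
  | .normLo k => decide (k < P.n) && decide ((sqNormIv B k).snd < P.rlo ^ 2)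
  | .normHi k => decide (k < P.n) && decide (P.rhi ^ 2 < (sqNormIv B k).fst)
  | .distLo k l => decide (k < P.n) && decide (l < P.n) && !(k == l) &&
      decide ((sqDistIv B k l).snd < P.dlo ^ 2)
  | .gap k l => decide (k < P.n) && decide (l < P.n) && !(k == l) &&
      decide (P.dhi ^ 2 < (sqDistIv B k l).fst) && decide ((sqDistIv B k l).snd < P.gap ^ 2)
  | .bondHi k l => decide (k < P.n) && decide (l < P.n) && decide ((k, l, true) ∈ S) &&
      decide (P.dhi ^ 2 < (sqDistIv B k l).fst)
  | .farLo k l => decide (k < P.n) && decide (l < P.n) && decide ((k, l, false) ∈ S) &&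
      decide ((sqDistIv B k l).snd < P.gap ^ 2)

/-- **The acceptance test**: `pat` is a pattern, `M` is exactly orthogonal, `σ` a permutation,
and every point `t k` of the box is within `eta − eps` of the placed anchor `M · anchor[σ k]`.
[cite: Moore1966, Theorem 3.1] -/
def acceptOK (B : Box) (pat : ℕ) (M : List ℚ) (σ : List ℕ) : Bool :=
  decide (pat < P.anchors.length) && matOrthoB M && permOK P.n σ &&
    (List.range P.n).all fun k =>
      decide ((sqDistPtIv B k (rotQ M (P.anchor pat (papp σ k)))).snd ≤ (P.eta - P.eps) ^ 2)

end Spec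

/-- **The certificate checker** (structural recursion; kernel-evaluable). The context `ctx`
lists the constraint lists whose claims are already established; `S` is the current constraint
list; the box is `none` before the frame is fixed. [folklore] -/
def Tree.check (P : Spec) (ctx : Array (List Constraint)) :
    List Constraint → Option Box → Tree → Bool
  | S, ob, .case k l tb tf => decide (k < P.n) && decide (l < P.n) && !(k == l) &&
      Tree.check P ctx ((k, l, true) :: S) ob tb && Tree.check P ctx ((k, l, false) :: S) ob tf
  | S, _, .ref π j =>
      match ctx[j]? with
      | none => false
      | some S₀ => permOK P.n π && (relabel π S₀).all fun c => decide (c ∈ S)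
  | S, none, .frame sub => Tree.check P ctx S (some P.rootBox) sub
  | _, some _, .frame _ => false
  | S, some B, .split axis cut lo hi =>
      Tree.check P ctx S (some (B.split axis cut).1) lo &&
        Tree.check P ctx S (some (B.split axis cut).2) hi
  | _, none, .split _ _ _ _ => false
  | S, some B, .empty w => P.witnessOK S B w
  | _, none, .empty _ => false
  | _, some B, .accept pat M σ => P.acceptOK B pat M σ
  | _, none, .accept _ _ _ => false

/-- A **census certificate**: constraint lists with their certificate trees, in dependency
order (a tree may refer back to earlier entries). [folklore] -/
abbrev Census : Type := List (List Constraint × Tree)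

/-- Check the entries in order, each against the context of the earlier ones. [folklore] -/
def Census.checkFrom (P : Spec) : Array (List Constraint) → Census → Bool
  | _, [] => true
  | ctx, (S, tr) :: rest => tr.check P ctx S none && Census.checkFrom P (ctx.push S) rest

/-- **The census checker**: the data are sound (`okB`), every entry checks, and some entry has
the empty constraint list (the unconditional claim). [folklore] -/
def Census.check (P : Spec) (C : Census) : Bool :=
  P.okB && Census.checkFrom P #[] C && C.any fun e => e.1.isEmpty

/-! ### Rational squared distances and anchor separation -/

/-- Squared distance of rational points. [folklore] -/
def sqDistQ (a b : ℚ × ℚ × ℚ) : ℚ :=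
  (a.1 - b.1) ^ 2 + (a.2.1 - b.2.1) ^ 2 + (a.2.2 - b.2.2) ^ 2

/-- `sqDistQ` is the squared distance of the real points. [folklore] -/
theorem dist_qpt_sq (a b : ℚ × ℚ × ℚ) : dist (qpt a) (qpt b) ^ 2 = sqDistQ a b := by
  rw [dist_sq_fin3, sqDistQ]
  simp only [qpt_apply_zero, qpt_apply_one, qpt_apply_two]
  push_cast
  ring

/-- **Anchor separation test** for pattern `i`: distinct anchors are more than `2·eps` apart
(so the exact pattern points are pairwise distinct). [folklore] -/
def Spec.anchorsSepB (P : Spec) (i : ℕ) : Bool :=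
  (List.range P.n).all fun j => (List.range P.n).all fun k =>
    (j == k) || decide ((2 * P.eps) ^ 2 < sqDistQ (P.anchor i j) (P.anchor i k))


/-! ### Text format for large certificates

A census of realistic size (10⁵–10⁷ nodes) cannot be elaborated as a Lean term; it is shipped
as a STRING of whitespace-separated integers and decoded at check time (`native_decide` runs the
decoder and the checker as compiled code; the decoder needs no correctness proof — soundness is
about whatever census it returns). Grammar (prefix, all tokens integers):

* census := `E` entry₁ … entry_E; entry := `L` (k l b)ᴸ tree (b ∈ {0,1}: far/bond);
* tree := `0 k l` tree tree (case) ∣ `1 L π₀…π_{L−1} j` (ref) ∣ `2` tree (frame)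
  ∣ `3 axis num den` tree tree (split at `num/den`) ∣ `4` witness (empty)
  ∣ `5 pat (num den)⁹ L σ₀…σ_{L−1}` (accept; matrix row-major)
  ∣ `6 pat a b c d s L σ₀…σ_{L−1}` (accept with the matrix `quatMat a b c d s` of an integer
    quaternion, `s = ±1`);
* witness := `0 a` (void) ∣ `1 k` (normLo) ∣ `2 k` (normHi) ∣ `3 k l` (distLo) ∣ `4 k l` (gap)
  ∣ `5 k l` (bondHi) ∣ `6 k l` (farLo).

Malformed input decodes to a census that fails the check. -/

namespace Text

/-- Tokenizer state. [folklore] -/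
structure PState where
  /-- tokens read so far -/
  toks : Array ℤ
  /-- magnitude of the number being read -/
  cur : ℕ
  /-- inside a number -/
  inNum : Bool
  /-- a minus sign was read -/
  neg : Bool

/-- Emit the pending number, if any. [folklore] -/
def flush (st : PState) : PState :=
  if st.inNum then
    { toks := st.toks.push (if st.neg then -(st.cur : ℤ) else (st.cur : ℤ)), cur := 0,
      inNum := false, neg := false }
  else { st with neg := false }

/-- Consume one character. [folklore] -/
def step (st : PState) (c : Char) : PState :=
  if c.isDigit then { st with cur := st.cur * 10 + (c.toNat - 48), inNum := true }
  else if c = '-' then { flush st with neg := true }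
  else flush st

/-- **Tokenize** a string into integers (any non-digit, non-minus character separates). [folklore] -/
def tokens (s : String) : Array ℤ := (flush (s.foldl step ⟨#[], 0, false, false⟩)).toks

/-- Token `i` as an integer (`0` beyond the end). [folklore] -/
def intAt (ts : Array ℤ) (i : ℕ) : ℤ := ts.getD i 0

/-- Token `i` as a natural number. [folklore] -/
def natAt (ts : Array ℤ) (i : ℕ) : ℕ := (intAt ts i).toNat

/-- Tokens `i, i+1` as the rational `num/den`. [folklore] -/
def ratAt (ts : Array ℤ) (i : ℕ) : ℚ := (intAt ts i : ℚ) / (natAt ts (i + 1) : ℚ)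

/-- Read `len` naturals from position `i`; returns them and the next position. [folklore] -/
def readNats (ts : Array ℤ) : ℕ → ℕ → List ℕ × ℕ
  | 0, i => ([], i)
  | len + 1, i =>
    let r := readNats ts len (i + 1)
    (natAt ts i :: r.1, r.2)

/-- Read `len` constraints `k l b` from position `i`. [folklore] -/
def readConstraints (ts : Array ℤ) : ℕ → ℕ → List Constraint × ℕ
  | 0, i => ([], i)
  | len + 1, i =>
    let r := readConstraints ts len (i + 3)
    ((natAt ts i, natAt ts (i + 1), intAt ts (i + 2) == 1) :: r.1, r.2)

/-- Decode a witness at position `i`. [folklore] -/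
def decodeWitness (ts : Array ℤ) (i : ℕ) : Option (Witness × ℕ) :=
  let tag := intAt ts i
  if tag = 0 then some (.void (natAt ts (i + 1)), i + 2)
  else if tag = 1 then some (.normLo (natAt ts (i + 1)), i + 2)
  else if tag = 2 then some (.normHi (natAt ts (i + 1)), i + 2)
  else if tag = 3 then some (.distLo (natAt ts (i + 1)) (natAt ts (i + 2)), i + 3)
  else if tag = 4 then some (.gap (natAt ts (i + 1)) (natAt ts (i + 2)), i + 3)
  else if tag = 5 then some (.bondHi (natAt ts (i + 1)) (natAt ts (i + 2)), i + 3)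
  else if tag = 6 then some (.farLo (natAt ts (i + 1)) (natAt ts (i + 2)), i + 3)
  else none

/-- Decode a tree at position `i` (`fuel` bounds the depth). [folklore] -/
def decodeTree (ts : Array ℤ) : ℕ → ℕ → Option (Tree × ℕ)
  | 0, _ => none
  | fuel + 1, i =>
    let tag := intAt ts i
    if tag = 0 then
      match decodeTree ts fuel (i + 3) with
      | none => none
      | some (tb, j) =>
        match decodeTree ts fuel j with
        | none => none
        | some (tf, j') => some (.case (natAt ts (i + 1)) (natAt ts (i + 2)) tb tf, j')
    else if tag = 1 then
      let r := readNats ts (natAt ts (i + 1)) (i + 2)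
      some (.ref r.1 (natAt ts r.2), r.2 + 1)
    else if tag = 2 then
      match decodeTree ts fuel (i + 1) with
      | none => none
      | some (t, j) => some (.frame t, j)
    else if tag = 3 then
      match decodeTree ts fuel (i + 4) with
      | none => none
      | some (lo, j) =>
        match decodeTree ts fuel j with
        | none => none
        | some (hi, j') => some (.split (natAt ts (i + 1)) (ratAt ts (i + 2)) lo hi, j')
    else if tag = 4 then
      match decodeWitness ts (i + 1) with
      | none => none
      | some (w, j) => some (.empty w, j)
    else if tag = 5 then
      let M := (List.range 9).map fun e => ratAt ts (i + 2 + 2 * e)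
      let r := readNats ts (natAt ts (i + 20)) (i + 21)
      some (.accept (natAt ts (i + 1)) M r.1, r.2)
    else if tag = 6 then
      let M := quatMat (intAt ts (i + 2)) (intAt ts (i + 3)) (intAt ts (i + 4)) (intAt ts (i + 5))
        (intAt ts (i + 6))
      let r := readNats ts (natAt ts (i + 7)) (i + 8)
      some (.accept (natAt ts (i + 1)) M r.1, r.2)
    else none

/-- Decode `count` entries from position `i`. [folklore] -/
def decodeEntries (ts : Array ℤ) : ℕ → ℕ → Option Census
  | 0, _ => some []
  | count + 1, i =>
    let r := readConstraints ts (natAt ts i) (i + 1)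
    match decodeTree ts (ts.size + 1) r.2 with
    | none => none
    | some (t, j) =>
      match decodeEntries ts count j with
      | none => none
      | some rest => some ((r.1, t) :: rest)

end Text

/-- **Decode a census from its text form** (the empty census — which fails the check — on
malformed input). [folklore] -/
def Census.ofText (s : String) : Census :=
  let ts := Text.tokens s
  (Text.decodeEntries ts (Text.natAt ts 0) 1).getD []


end ShellCensus

end Literature.Geometry.DiscreteGeometry
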